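import Summits.HodgeConjecture.HodgeConjecture.Theorems.F0P6aModuliDatumDefs
import Literature.AlgebraicGeometry.AbelianSchemes.FrobeniusHeartSigma2Assembly
import Literature.AlgebraicGeometry.AbelianSchemes.AbelianSchemeOverSectionPow
import Literature.NumberTheory.NumberFields.SerreTensorPresentationOfIdeal
import Literature.AlgebraicGeometry.AbelianSchemes.TupleIsoAtOfFibreIsoPoints
import Literature.AlgebraicGeometry.Motives.GaloisThickeningPointsGalois
import HarnessLib

/-!
# `F0P6aStubHFROBSigma2` — ★ RE-HOME (rung-0 re-homing task, books INVENTORY §8.4 M-3; LEAD F0P6-plan (g4) «M-72») of the crux workfile `Lines/F0_P6a_StubHFROBSigma2.lean`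

This `Theorems/` module is the TREE BYTES of `Summits/HodgeConjecture/HodgeConjecture/Cruxes/HLiu418/Lines/F0_P6a_StubHFROBSigma2.lean` (edition of record,
tree sha16 caf8fdbf504358ff, 186 l., code-`sorry`-free) with the NAMESPACE KEPT — `Summit.HodgeConjecture.HodgeConjecture.Cruxes.HLiu418.F0P6aStubHFROBSigma2` — so that every
fully-qualified name (`lvlPt₀Of_pow_eq_one`, `sigma2_output`, `heartFrob_of_twistIdeal_ne_bot`; 3 declarations) is UNCHANGED; only this module
docstring is re-headed and the `Lines` imports are switched to their ★ re-homed twins (`F0_P6a_ModuliDatumDefs` → `Theorems.F0P6aModuliDatumDefs`).  Why a re-home: a `Theorems/` file cannot import a `Lines/` workfile (F0P6-ref1 o-6), and closing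
stmt-HodgeConjecture-24832 `--as proved --by <Theorems decl>` at rung 0 needs the sorry-free Lines chain behind the gate (RE-HOME MAP v1.1, LA7-plan (g4),
2026-09-02; director g27 s1336 (R1)–(R3)).    Lines importers of the original: `F0_P6a_ModuliDatum`.
After this file is ★ the Lines workfile is meant to become a one-import SHIM of it (a `Lines/` write, batched per cone on the LEAD's word), so no
environment ever holds two copies (NO-CROSS-IMPORT rule, «M-72» (3)).  It asserts nothing beyond what the workfile already proves.

## Original module docstring (verbatim)
# `stub_HFROB`, σ2 OUTPUT AT THE MODULI DATUM: the exact identification `A_{red₀(σ•y)} ≅ A_{red₀(quotΩ y L)}` of special-fibre tuples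

Cell `hodgecm-mathlib` (D-0151), FLOOR 0, P6 «MOD programme», crux hLiu418 = stmt-HodgeConjecture-24832 (count-neutral `--supports`), line
`Cruxes/HLiu418/Lines/F0_P6a_ModuliDatum.lean` (ED. 4∕5), stub **`stub_HFROB : RecordHeartFrobenius`**, σ2 (β′) hand «SERRE-TENSOR RECOGNITION OF `A^{(q)}`».
THEOREMS ONLY; home `Cruxes/HLiu418/Lines/F0_P6a_StubHFROBSigma2.lean` (a `Theorems/` module may not import the Defs — gate lint `lint.import`).  This file instantiates ★ BRICK Σ `AbelianSchemeOver.sigma2_assembly_of_polarizations` ONCE at the datum's downstairs readings — `Roof₀`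
(`𝔇.frob₀.quot₀_roof`: (r1₀)(r2₀)(r3₀)(r4₀)(r5₀)(rL)) and `FrobCover₀` (`𝔇.frob₀.frob₀_cover`: (f1′)(f3)(f4)(f5)), `frobIdeal_spec` (`𝔠𝔭_w = 𝔞_γ`), `twistNorm_eq`
(`n_γ = q`), (f6) `twistIdeal_coprime` — with the Serre presentations of `𝔭_w`, `𝔠(gam)`, `𝔞_γ` from ★ `SerrePresentation.exists_serrePresentation_of_ideal`, and returns
EXACTLY the four clauses σ1's skeleton v2 (A-p03 (g30)) consumes before ★ `exists_tupleRel_baseChange_comp_of_iso_symm_of_points` and `𝔇.inj₀`: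
an isomorphism `f : A_{x̄′} ≅ A_{x̄″}` (`x̄′ := red₀ (σ • y)`, `x̄″ := red₀ (quotΩ y L)`) which is a homomorphism, `λ`-exact in dual-homomorphism form, carries the
level points, and commutes with `ι`.  HYPOTHESIS `h𝔞 : 𝔇.twistIdeal gam ≠ ⊥` (the presentations need nonzero ideals; not a Defs ED. 2 field — LEAD ruling pending:
field `twistIdeal_ne_bot` or a degenerate-branch lemma).  HC_CM is proved only modulo the 2 remaining named inputs (hLiu418 24832, h413 24833) until rung 0
closes; this file discharges none of them.

CAND v2 (A-p04 (g23), n3 cure of A-p13 (g36) cand v1): the three public statements `lvlPt₀Of_pow_eq_one`, `sigma2_output`, `heartFrob_of_twistIdeal_ne_bot` and the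
imports are BYTE-IDENTICAL with cand v1; only the proof of `sigma2_output` is re-threaded (`Exists.elim` ∕ projections instead of `rcases`), so that `sigma2_output` runs at
`maxHeartbeats 400000` (measured: fails at 200 000, passes at 300 000) and `heartFrob_of_twistIdeal_ne_bot` at the DEFAULT budget (cand v1: 1 600 000 ∕ 800 000).

## References
* [Liu2021] Y. Liu, Prop. D.8 (3) (p. 135, proof pp. 136–138).
* [Shimura1998] G. Shimura, §13.1 Thm. 1 (pp. 97–99); §18.6 (p. 127).
* [MumfordAV1970] D. Mumford, *Abelian Varieties* (1970), §7 Thm. 4 (p. 72), §15 Thm. 1 (p. 143), §23 (p. 231).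
* [MumfordFogartyKirwan1994] Ch. 7 §2 Definition 7.1 (p. 129), §3 Theorem 7.9 (p. 139).
-/

set_option autoImplicit false
set_option linter.dupNamespace false  -- `Summit.HodgeConjecture.HodgeConjecture.…` BY DESIGN (D-0017)

noncomputable section

open CategoryTheory NumberField IsDedekindDomain MulAction
open scoped Matrix
open Literature.NumberTheory.GaloisRepresentations
open Literature.NumberTheory.Automorphic Literature.NumberTheory.Automorphic.UnitaryGroup
open Literature.AlgebraicGeometry.ShimuraVarieties.UnitaryCanonicalModel
open Literature.NumberTheory.Automorphic.Liu2021.AppendixC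
open Literature.AlgebraicGeometry.Motives (AlgPoints IntegralModel frobeniusOver SchemeOver thickening thickeningGalAction thickeningLift
  specOver relFrobeniusOver frobeniusTwistOver frobSpec)
open Literature.NumberTheory.DiophantineGeometry (geomResidueField specialFibreFunctor)
open Literature.AlgebraicGeometry.RelativeSpec (ActionOver)
open Literature.AlgebraicGeometry.AbelianSchemes Literature.AlgebraicGeometry.AbelianSchemes.AbelianSchemeOver
open Literature.NumberTheory.NumberFields.SerrePresentation (exists_serrePresentation_of_ideal)
open Summit.HodgeConjecture.HodgeConjecture.Cruxes.HLiu418.F0P6aModuliDatumDefs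

namespace Summit.HodgeConjecture.HodgeConjecture.Cruxes.HLiu418.F0P6aStubHFROBSigma2

/-- The level points `σ^a(x̄) ∈ A_x̄(κ̄)` of the datum are `N`-torsion (★ `restrictPt_sectionPow_pow_card`; `N = 0` is the trivial case `x ^ 0 = 1`).
[cite: MumfordFogartyKirwan1994, Ch. 7 §2 Definition 7.1 (p. 129)] -/
theorem lvlPt₀Of_pow_eq_one {F : Type} [Field F] [NumberField F] {X : SchemeOver F}
    (𝓜 : IntegralModel (𝓞 F) F X) (w : HeightOneSpectrum (𝓞 F))
    (𝒜 : AbelianSchemeOver (𝓜.localise w).total.left) {g N : ℕ} (lvl : 𝒜.LevelStructure g N)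
    (xbar : AlgPoints (𝓜.localise w).reductionAt (geomResidueField w)) (a : Fin g ⊕ Fin g → ZMod N) :
    lvlPt₀Of 𝓜 w 𝒜 lvl xbar a ^ N = 1 := by
  rcases Nat.eq_zero_or_pos N with h0 | hpos
  · have key : ∀ (n : ℕ) (x : (fibre₀Of 𝓜 w 𝒜 xbar).Points (geomResidueField w)), n = 0 → x ^ n = 1 :=
      fun n x h => h ▸ pow_zero x
    exact key N _ h0
  · haveI : NeZero N := ⟨hpos.ne'⟩
    exact (𝒜.baseChange (CategoryTheory.Limits.pullback.fst (𝓜.localise w).total.hom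
        (Literature.NumberTheory.DiophantineGeometry.specResidueField w))).restrictPt_sectionPow_pow_card xbar.left _
      (fun k => restrictPt_pow_eq_one _ _ ((lvl.baseChange _).pow_σ k)) a

set_option maxHeartbeats 400000 in
/-- **σ2 OUTPUT FOR `stub_HFROB`** — for a moduli datum `𝔇`, an arithmetic Frobenius `σ` read by `gam` on the sheet `e`, a point `y` and a line `L` specialising to `ker F`, and
`𝔞_γ ≠ 0`: the special-fibre tuples at `x̄′ = red₀ (σ • y)` and `x̄″ = red₀ (quotΩ y L)` are joined by an ISOMORPHISM of abelian `κ̄(w)`-schemes `f : A_{x̄′} ≅ A_{x̄″}` which is a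
homomorphism, EXACT on `λ` (`f ≫ λ_{x̄″} ≫ f^∨ = λ_{x̄′}`), carries the level points (`f(σ^a(x̄′)) = σ^a(x̄″)`), and commutes with `ι` — the four clauses of σ1's skeleton v2, obtained by
instantiating ★ BRICK Σ `sigma2_assembly_of_polarizations` at `𝔇.frob₀.quot₀_roof` ∕ `𝔇.frob₀.frob₀_cover` ∕ `frobIdeal_spec` ∕ `twistNorm_eq` ∕ `twistIdeal_coprime` with the Serre
presentations of `𝔭_w`, `𝔠(gam)`, `𝔞_γ` (★ `exists_serrePresentation_of_ideal`). [cite: Liu2021, Prop. D.8 (3) (p. 135, proof pp. 136–138)] [cite: Shimura1998, §13.1 Thm. 1 (pp. 97–99); §18.6 (p. 127)]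
[cite: MumfordAV1970, §15 Thm. 1 (p. 143), §23 (p. 231)] [cite: MumfordFogartyKirwan1994, Ch. 7 §3 Theorem 7.9 (p. 139)] -/
theorem sigma2_output {F : Type} [Field F] [NumberField F] [IsCMField F] {ι₁ : F →+* ℂ} {Jstar : Matrix (Fin 2) (Fin 2) F}
    {K₀ : C5.OpenCompactSubgroup ↥(finAdelic ↥(maximalRealSubfield F) F (IsCMField.complexConj F) 2 Jstar)}
    {S : RecordSystemGS F Jstar ι₁ K₀} {hU7ₛ : S.HeckeTranslateDefinedOver}
    {hJ : (Jstar.map (IsCMField.complexConj F))ᵀ = Jstar} {hJu : IsUnit Jstar}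
    {Fi : Type} [Field Fi] [Algebra F Fi] {Kc : C5.SmallLevel K₀} {G : Type} [Group G]
    {𝓜 : IntegralModel (𝓞 F) F ((thickening F Fi).obj (S.M.obj Kc))}
    {w : HeightOneSpectrum (𝓞 F)} {hw : (IsCMField.complexConj F) • w ≠ w} {h𝓨 : (𝓜.localise w).IsSmoothProper 1}
    {θ : ActionOver (𝓜.localise w).total.hom ((Fi ≃ₐ[F] Fi) × G)} {e : Fi →ₐ[F] AlgebraicClosure (w.adicCompletion F)}
    (𝔇 : ModuliDatum F ι₁ Jstar K₀ S hU7ₛ hJ hJu Fi Kc G 𝓜 w hw h𝓨 θ e)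
    (σ : Field.absoluteGaloisGroup (w.adicCompletion F)) (hσ : IsAbsArithFrob σ) (gam : Fi ≃ₐ[F] Fi)
    (hγ : ((AlgEquiv.restrictScalars F (Field.absoluteGaloisGroup.toAlgEquiv (w.adicCompletion F) σ) :
        AlgebraicClosure (w.adicCompletion F) ≃ₐ[F] AlgebraicClosure (w.adicCompletion F)) :
        AlgebraicClosure (w.adicCompletion F) →ₐ[F] AlgebraicClosure (w.adicCompletion F)).comp e = e.comp (gam : Fi →ₐ[F] Fi))
    (h𝔞 : 𝔇.twistIdeal gam ≠ ⊥)
    (y : AlgPoints (S.M.obj Kc) (AlgebraicClosure (w.adicCompletion F))) (L : 𝔇.Line y)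
    (hsp : 𝔇.sp y L = 𝔇.kerF (red₀Of S Kc 𝓜 w h𝓨 e y)) :
    ∃ (f : (sch₀Of 𝓜 w 𝔇.univ (red₀Of S Kc 𝓜 w h𝓨 e (σ • y))).X ≅ (sch₀Of 𝓜 w 𝔇.univ (red₀Of S Kc 𝓜 w h𝓨 e (𝔇.quotΩ y L))).X)
      (_ : IsMonHom f.hom),
      f.hom ≫ (pol₀Of 𝓜 w 𝔇.univ 𝔇.pol (red₀Of S Kc 𝓜 w h𝓨 e (𝔇.quotΩ y L))).lam ≫
          DualPair.dualIsogenyOver f.hom (dual₀Of 𝓜 w 𝔇.univ 𝔇.dual (red₀Of S Kc 𝓜 w h𝓨 e (σ • y)))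
            (dual₀Of 𝓜 w 𝔇.univ 𝔇.dual (red₀Of S Kc 𝓜 w h𝓨 e (𝔇.quotΩ y L))) =
        (pol₀Of 𝓜 w 𝔇.univ 𝔇.pol (red₀Of S Kc 𝓜 w h𝓨 e (σ • y))).lam ∧
      (∀ a, AlgPoints.map f.hom (lvlPt₀Of 𝓜 w 𝔇.univ 𝔇.lvl (red₀Of S Kc 𝓜 w h𝓨 e (σ • y)) a) =
        lvlPt₀Of 𝓜 w 𝔇.univ 𝔇.lvl (red₀Of S Kc 𝓜 w h𝓨 e (𝔇.quotΩ y L)) a) ∧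
      (∀ a, (act₀Of 𝓜 w 𝔇.univ 𝔇.act a (red₀Of S Kc 𝓜 w h𝓨 e (σ • y))).hom.hom.hom ≫ f.hom =
        f.hom ≫ (act₀Of 𝓜 w 𝔇.univ 𝔇.act a (red₀Of S Kc 𝓜 w h𝓨 e (𝔇.quotΩ y L))).hom.hom.hom) := by
  haveI : CharP (geomResidueField w) 𝔇.pChar := 𝔇.charP₀
  haveI : ExpChar (geomResidueField w) 𝔇.pChar := ExpChar.prime 𝔇.hpChar.1
  -- n3 CURE (cand v2, A-p04 (g23)): every existential below — roof, cover, the three Serre presentations, ★ BRICK Σ — is opened with `Exists.elim` and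
  -- `.1 ∕ .2` projections instead of `obtain ⟨…⟩` (`rcases` on this goal was the heartbeat hog: 1 600 000 in cand v1; now ≤ 300 000 measured, 400 000 declared).
  -- (1) the downstairs roof of the canonical translate (r1₀)(r2₀)(r3₀)(r4₀)(r5₀)(rL)
  refine Exists.elim (𝔇.frob₀.quot₀_roof σ hσ gam hγ y L hsp) fun Bb h => h.elim fun DB h => h.elim fun lamB h => h.elim fun hlamB h =>
    h.elim fun hDBu h => h.elim fun qb h => h.elim fun hqb h => h.elim fun cb h => h.elim fun hcb hr => ?_
  have hqflat := hr.1; have hqsurj := hr.2.1; have hcker := hr.2.2.1; have hcsurj := hr.2.2.2.1; have hr3q := hr.2.2.2.2.1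
  have hr3c := hr.2.2.2.2.2.1; have hequiv := hr.2.2.2.2.2.2.1; have hr5 := hr.2.2.2.2.2.2.2.1; have hrL := hr.2.2.2.2.2.2.2.2
  -- (2) the Frobenius cover of the reduction of `σ • y` (f1′)(f3)(f4)(f5), the norm pin, the co-ideal law
  refine Exists.elim (𝔇.frob₀.frob₀_cover σ hσ gam hγ y) fun cb' h => h.elim fun hcb' hc => ?_
  have hc'ker := hc.2.1; have hc'surj := hc.2.2.1; have hf3 := hc.2.2.2.1; have hf4 := hc.2.2.2.2.1; have hf5 := hc.2.2.2.2.2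
  have hn : 𝔇.twistNorm gam = 𝔇.pChar ^ 𝔇.fDeg := 𝔇.frob₀.twistNorm_eq σ hσ gam hγ
  have h𝔠𝔭 : 𝔇.frob₀.frobIdeal gam * w.asIdeal = 𝔇.twistIdeal gam := 𝔇.frob₀.frobIdeal_spec σ hσ gam hγ
  have hmul : w.asIdeal * 𝔇.frob₀.frobIdeal gam = 𝔇.twistIdeal gam := by rw [mul_comm]; exact h𝔠𝔭
  have h𝔠0 : 𝔇.frob₀.frobIdeal gam ≠ ⊥ := fun h => h𝔞 (by rw [← h𝔠𝔭, h, Ideal.bot_mul])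
  -- (3) Serre presentations of `𝔭_w`, `𝔠(gam)`, `𝔞_γ`
  refine (exists_serrePresentation_of_ideal w.asIdeal w.ne_bot).elim fun m₁ h => h.elim fun E₁ h => h.elim fun hE₁ h =>
    h.elim fun P₁ h => h.elim fun Q₁ h => h.elim fun N₁ h₁ => ?_
  refine (exists_serrePresentation_of_ideal (𝔇.frob₀.frobIdeal gam) h𝔠0).elim fun m₂ h => h.elim fun E₂ h => h.elim fun hE₂ h =>
    h.elim fun P₂ h => h.elim fun Q₂ h => h.elim fun N₂ h₂ => ?_
  refine (exists_serrePresentation_of_ideal (𝔇.twistIdeal gam) h𝔞).elim fun m₃ h => h.elim fun E₃ h => h.elim fun hE₃ h =>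
    h.elim fun P₃ h => h.elim fun Q₃ h => h.elim fun N₃ h₃ => ?_
  have hN₁ := h₁.1; have hP₁ := h₁.2.1; have hQ₁ := h₁.2.2.1; have hQP₁ := h₁.2.2.2.1; have hPQ₁ := h₁.2.2.2.2.1
  have hsp₁ := h₁.2.2.2.2.2.1
  have hN₂ := h₂.1; have hP₂ := h₂.2.1; have hQ₂ := h₂.2.2.1; have hQP₂ := h₂.2.2.2.1; have hPQ₂ := h₂.2.2.2.2.1
  have hsp₂ := h₂.2.2.2.2.2.1
  have hN₃ := h₃.1; have hP₃ := h₃.2.1; have hQ₃ := h₃.2.2.1; have hQP₃ := h₃.2.2.2.1; have hPQ₃ := h₃.2.2.2.2.1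
  have hsp₃ := h₃.2.2.2.2.2.1; have hQ𝔠 := h₃.2.2.2.2.2.2.1; have h𝔠₃ := h₃.2.2.2.2.2.2.2
  -- the base-changed ring actions: `(act₀Of … a x̄).hom.hom.hom = (actAt x̄).i a` by `rfl`
  let ι_s := CategoryTheory.Limits.pullback.fst (𝓜.localise w).total.hom (Literature.NumberTheory.DiophantineGeometry.specResidueField w)
  let actAt : ∀ xb : AlgPoints (𝓜.localise w).reductionAt (geomResidueField w), (sch₀Of 𝓜 w 𝔇.univ xb).RingAction (𝓞 F) :=
    fun xb => (𝔇.act.baseChange ι_s).baseChange xb.left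
  haveI := hqb
  haveI := hcb
  haveI := hcb'
  haveI := hlamB
  -- (4) ★ BRICK Σ at the datum
  refine Exists.elim (sigma2_assembly_of_polarizations 𝔇.pChar 𝔇.fDeg (actAt (red₀Of S Kc 𝓜 w h𝓨 e y)) (actAt (red₀Of S Kc 𝓜 w h𝓨 e (σ • y)))
      (actAt (red₀Of S Kc 𝓜 w h𝓨 e (𝔇.quotΩ y L))) E₁ hE₁ P₁ Q₁ E₂ hE₂ P₂ Q₂ E₃ hE₃ P₃ Q₃ qb cb cb' 𝔇.hpChar.1
      hN₁ hP₁ hQ₁ hQP₁ hPQ₁ hN₂ hP₂ hQ₂ hQP₂ hPQ₂ hN₃ hP₃ hQ₃ hQP₃ hPQ₃ (Set.range fun k => Q₃ 0 k) hQ𝔠 h𝔠₃ hsp₁ hsp₂ hsp₃ hmul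
      (pol₀Of 𝓜 w 𝔇.univ 𝔇.pol (red₀Of S Kc 𝓜 w h𝓨 e y)) (pol₀Of 𝓜 w 𝔇.univ 𝔇.pol (red₀Of S Kc 𝓜 w h𝓨 e (σ • y)))
      (pol₀Of 𝓜 w 𝔇.univ 𝔇.pol (red₀Of S Kc 𝓜 w h𝓨 e (𝔇.quotΩ y L))) DB lamB hDBu hqflat hqsurj hcker hcsurj 𝔇.hpChar.1.ne_zero
      hr3q hr3c hequiv hrL hc'ker hc'surj hf3 hn hf4) fun f h => h.elim fun hfmon hf => ?_
  refine ⟨f, hfmon, hf.2.1, fun a => ?_, hf.1⟩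
  -- (5) the level clause: (r5₀) + (f5) + `N`-torsion + (f6)
  exact hf.2.2 (𝔇.twistIdeal_coprime gam) _ _ _ (lvlPt₀Of_pow_eq_one 𝓜 w 𝔇.univ 𝔇.lvl _ a) (lvlPt₀Of_pow_eq_one 𝓜 w 𝔇.univ 𝔇.lvl _ a)
    (hr5 a) (hf5 a)

/-- **HEART-FROB′ FOR A DATUM WHOSE TWIST IDEALS ARE NONZERO** — the σ1 ∕ σ2 assembly of `stub_HFROB` COMPLETE modulo the one side condition `∀ γ, 𝔞_γ ≠ 0`: read `σ` on the sheet
`e` by `γ` (★ `exists_algEquiv_comp_eq_comp`), take the σ2 OUTPUT `f : A_{red₀(σ•y)} ≅ A_{red₀(quotΩ y L)}` (`sigma2_output`), transfer it to a `tupleIsoAt` between the single pull-backs along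
`spPt` (σ1's ★ BRICK T `exists_tupleRel_baseChange_comp_of_iso_symm_of_points`, A-p03 (g30)), and conclude by fine-moduli injectivity on the sheet (`𝔇.inj₀`).  With a Defs field
`twistIdeal_ne_bot` (or a degenerate-branch lemma) this is `stub_HFROB` itself: `fun … 𝔇 => heartFrob_of_twistIdeal_ne_bot 𝔇 𝔇.twistIdeal_ne_bot`.
[cite: Liu2021, Prop. D.8 (3) (p. 135, proof pp. 136–138)] [cite: MumfordFogartyKirwan1994, Ch. 7 §3 Theorem 7.9 (p. 139)] [cite: Shimura1998, §13.1 Thm. 1 (pp. 97–99); §18.6 (p. 127)] -/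
theorem heartFrob_of_twistIdeal_ne_bot {F : Type} [Field F] [NumberField F] [IsCMField F] {ι₁ : F →+* ℂ} {Jstar : Matrix (Fin 2) (Fin 2) F}
    {K₀ : C5.OpenCompactSubgroup ↥(finAdelic ↥(maximalRealSubfield F) F (IsCMField.complexConj F) 2 Jstar)}
    {S : RecordSystemGS F Jstar ι₁ K₀} {hU7ₛ : S.HeckeTranslateDefinedOver}
    {hJ : (Jstar.map (IsCMField.complexConj F))ᵀ = Jstar} {hJu : IsUnit Jstar}
    {Fi : Type} [Field Fi] [Algebra F Fi] [Normal F Fi] {Kc : C5.SmallLevel K₀} {G : Type} [Group G]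
    {𝓜 : IntegralModel (𝓞 F) F ((thickening F Fi).obj (S.M.obj Kc))}
    {w : HeightOneSpectrum (𝓞 F)} {hw : (IsCMField.complexConj F) • w ≠ w} {h𝓨 : (𝓜.localise w).IsSmoothProper 1}
    {θ : ActionOver (𝓜.localise w).total.hom ((Fi ≃ₐ[F] Fi) × G)} {e : Fi →ₐ[F] AlgebraicClosure (w.adicCompletion F)}
    (𝔇 : ModuliDatum F ι₁ Jstar K₀ S hU7ₛ hJ hJu Fi Kc G 𝓜 w hw h𝓨 θ e) (hne : ∀ gam : Fi ≃ₐ[F] Fi, 𝔇.twistIdeal gam ≠ ⊥) :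
    𝔇.HeartFrob := by
  intro σ hσ y L hsp
  -- (0) read `σ` on the sheet `e`
  obtain ⟨gam, hgam⟩ := Literature.AlgebraicGeometry.Motives.exists_algEquiv_comp_eq_comp
    (σ := (AlgEquiv.restrictScalars F (Field.absoluteGaloisGroup.toAlgEquiv (w.adicCompletion F) σ))) (e := e)
  -- (1)–(4) the σ2 output
  obtain ⟨f, hfmon, hlam, hlvl, hact⟩ := sigma2_output 𝔇 σ hσ gam hgam (hne gam) y L hsp
  -- (T) σ1's transfer brick: the fibre iso IS a `tupleIsoAt` between the single pull-backs along `spPt`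
  haveI := hfmon
  have ht : tupleIsoAt (spPt 𝓜 w (red₀Of S Kc 𝓜 w h𝓨 e (𝔇.quotΩ y L))) (spPt 𝓜 w (red₀Of S Kc 𝓜 w h𝓨 e (σ • y)))
      𝔇.univ 𝔇.act 𝔇.dual 𝔇.pol 𝔇.lvl :=
    exists_tupleRel_baseChange_comp_of_iso_symm_of_points 𝔇.univ 𝔇.act 𝔇.dual 𝔇.pol 𝔇.lvl
      (CategoryTheory.Limits.pullback.fst (𝓜.localise w).total.hom (Literature.NumberTheory.DiophantineGeometry.specResidueField w))
      _ _ f hlam hlvl hact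
  -- (5) INJ on the sheet `e`
  exact 𝔇.inj₀ _ _ ht

end Summit.HodgeConjecture.HodgeConjecture.Cruxes.HLiu418.F0P6aStubHFROBSigma2

end
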